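import Summits.FinalStateConjecture.FinalStateConjecture.Theorems.UniformPhotonSphereChannels.Negative.NearKernelStatic
import Summits.FinalStateConjecture.FinalStateConjecture.Theorems.ChannelsResolveTameDevelopments.Negative.ExteriorEnergyAntitone
import Summits.FinalStateConjecture.FinalStateConjecture.Theorems.PhotonSphereChannelsRWPotential
import Literature.Geometry.Lorentzian.ReggeWheelerTortoise
import Literature.Geometry.Lorentzian.ReggeWheelerChannels

/-!
# Route PhotonSphereChannels · `UniformPhotonSphereChannels` (K1) — the kernel deficit of odd
# (velocity) data dominates the near-side velocity energy

Support file for item stmt-FinalStateConjecture-10045 (registered sub-goal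
`stub_kernelDeficit_ge_velocityEnergy` of prover seat 1).  For a potential `V ∈ C¹`, `V ≥ 0`,
`V ≤ C e^{κx}` on the near half-line `(−∞, x_c − ρ)`, and ANY `ψ ∈ C²(ℝ²)` with `ψ(0,·) = 0` whose
near velocity energy `D = ∫⁻_{x < x_c−ρ} ψ_t(0,x)²` is finite,

  `D ≤ kernelDeficit V x_c ρ ψ = inf_{p ∈ P(ρ)} ∫⁻_{ρ<|x−x_c|} e[ψ − p](0, x)`

(`lintegral_velocity_sq_le_kernelDeficit`).  Proof: fix `p ∈ P(ρ)` (a `C²` `t`-polynomial solution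
on the open exterior cone, which contains the near cone `{x + |t| < x_c − ρ}`).  If the near energy of
`ψ − p` at `t = 0` is infinite there is nothing to prove; otherwise `p` itself has finite near energy
at `t = 0` (`e[p] ≤ 2 e[ψ−p] + 2 ψ_t²`), hence is STATIC on the near cone by the kernel census
`KernelCensus.static_of_finite_energy` (disprover seat of this item), so `p_t(0,·) = 0` there and
`e[ψ − p](0,x) ≥ ψ_t(0,x)²`.  The Regge–Wheeler instance (`stub_kernelDeficit_ge_velocityEnergy`)
uses the horizon tail bound `rwPotential_tortoise_le_exp`.  No definitions are introduced.
-/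

noncomputable section

open Set Filter MeasureTheory Topology Function Finset

namespace Summit.FinalStateConjecture.FinalStateConjecture.Theorems.RestPacket

open Summit.FinalStateConjecture.FinalStateConjecture.Theorems.WaveEnergy
open Summit.FinalStateConjecture.FinalStateConjecture.Theorems.KernelCensus
open Literature.Geometry.Lorentzian.ReggeWheeler

/-- Slices of a function `C²` on an open set are differentiable at interior points (time slice). -/
theorem differentiableAt_slice_fst_of_contDiffOn {p : ℝ → ℝ → ℝ} {S : Set (ℝ × ℝ)} (hS : IsOpen S)
    (hp : ContDiffOn ℝ 2 (uncurry p) S) {t x : ℝ} (hz : (t, x) ∈ S) :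
    DifferentiableAt ℝ (fun τ => p τ x) t := by
  have h : DifferentiableAt ℝ (uncurry p) (t, x) :=
    (hp.contDiffAt (hS.mem_nhds hz)).differentiableAt (by norm_num)
  have h2 : DifferentiableAt ℝ (fun τ : ℝ => (τ, x)) t :=
    differentiableAt_id.prodMk (differentiableAt_const x)
  exact h.comp t h2

/-- Slices of a function `C²` on an open set are differentiable at interior points (space slice). -/
theorem differentiableAt_slice_snd_of_contDiffOn {p : ℝ → ℝ → ℝ} {S : Set (ℝ × ℝ)} (hS : IsOpen S)
    (hp : ContDiffOn ℝ 2 (uncurry p) S) {t x : ℝ} (hz : (t, x) ∈ S) :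
    DifferentiableAt ℝ (p t) x := by
  have h : DifferentiableAt ℝ (uncurry p) (t, x) :=
    (hp.contDiffAt (hS.mem_nhds hz)).differentiableAt (by norm_num)
  have h2 : DifferentiableAt ℝ (fun y : ℝ => (t, y)) x :=
    (differentiableAt_const t).prodMk differentiableAt_id
  have : p t = uncurry p ∘ fun y : ℝ => (t, y) := funext fun y => rfl
  rw [this]
  exact h.comp x h2

/-- The near cone `{x + |t| < x_c − ρ}` is open. -/
theorem isOpen_nearCone (e₀ : ℝ) : IsOpen {z : ℝ × ℝ | z.2 + |z.1| < e₀} :=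
  isOpen_lt (by fun_prop) continuous_const

/-- The near cone lies in the exterior cone. -/
theorem nearCone_subset_exteriorCone (xc ρ : ℝ) :
    {z : ℝ × ℝ | z.2 + |z.1| < xc - ρ} ⊆ exteriorCone xc ρ := by
  intro z hz
  simp only [mem_setOf_eq] at hz
  rw [mem_exteriorCone]
  have : xc - z.2 ≤ |z.2 - xc| := by
    rw [abs_sub_comm]; exact le_abs_self _
  linarith

/-- **The kernel deficit dominates the near velocity energy of odd data.** See the module
docstring. -/
theorem lintegral_velocity_sq_le_kernelDeficit {V : ℝ → ℝ} (hV : ContDiff ℝ 1 V)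
    (hV0 : ∀ x, 0 ≤ V x) {C κ : ℝ} (hκ : 0 < κ) (hC : 0 ≤ C) {xc ρ : ℝ}
    (hVexp : ∀ x < xc - ρ, V x ≤ C * Real.exp (κ * x))
    {ψ : ℝ → ℝ → ℝ} (hψ : ContDiff ℝ 2 (uncurry ψ)) (h0 : ∀ x, ψ 0 x = 0)
    (hfin : ∫⁻ x in Iio (xc - ρ), ENNReal.ofReal (deriv (fun τ => ψ τ x) 0 ^ 2) < ⊤) :
    ∫⁻ x in Iio (xc - ρ), ENNReal.ofReal (deriv (fun τ => ψ τ x) 0 ^ 2)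
      ≤ kernelDeficit V xc ρ ψ := by
  set e₀ : ℝ := xc - ρ with he₀
  set g : ℝ → ℝ := fun x => deriv (fun τ => ψ τ x) 0 with hg_def
  -- `g` is continuous (hence measurable)
  have hgc : Continuous g := by
    have : g = fun x => fderiv ℝ (uncurry ψ) (0, x) (1, 0) :=
      funext fun x => deriv_slice_fst_eq hψ 0 x
    rw [this]
    exact (continuous_fderiv_apply hψ (1, 0)).comp (Continuous.prodMk_right 0)
  have hψx : ∀ x, deriv (ψ 0) x = 0 := fun x => by
    have : ψ 0 = fun _ => 0 := funext h0
    rw [this, deriv_const]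
  unfold kernelDeficit
  refine le_iInf₂ fun p hp => ?_
  -- restrict the deficit integral to the near half-line
  have hsub : Iio e₀ ⊆ {x : ℝ | ρ < |x - xc|} := fun x hx => by
    simp only [Set.mem_Iio, he₀] at hx
    simp only [mem_setOf_eq]
    have : xc - x ≤ |x - xc| := by rw [abs_sub_comm]; exact le_abs_self _
    linarith
  refine le_trans ?_ (lintegral_mono_set hsub)
  -- the kernel element on the near cone
  obtain ⟨hpC, hpsol, hpoly⟩ := hp
  set Nc : Set (ℝ × ℝ) := {z : ℝ × ℝ | z.2 + |z.1| < e₀} with hNc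
  have hNo : IsOpen Nc := isOpen_nearCone e₀
  have hNsub : Nc ⊆ exteriorCone xc ρ := nearCone_subset_exteriorCone xc ρ
  have hpC' : ContDiffOn ℝ 2 (uncurry p) Nc := hpC.mono hNsub
  have hsol' : ∀ z : ℝ × ℝ, z.2 + |z.1| < e₀ →
      iteratedDeriv 2 (fun τ => p τ z.2) z.1 - iteratedDeriv 2 (p z.1) z.2 + V z.2 * p z.1 z.2 = 0 :=
    fun z hz => hpsol z (hNsub hz)
  have hpoly' : ∃ (N : ℕ) (a : ℕ → ℝ → ℝ), ∀ z : ℝ × ℝ, z.2 + |z.1| < e₀ →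
      p z.1 z.2 = ∑ i ∈ range N, a i z.2 * z.1 ^ i := by
    obtain ⟨N, a, ha⟩ := hpoly
    exact ⟨N, a, fun z hz => ha z (hNsub hz)⟩
  -- membership of `(0, x)` in the near cone for `x < e₀`
  have hmem0 : ∀ x, x < e₀ → ((0 : ℝ), x) ∈ Nc := fun x hx => by
    simp only [hNc, mem_setOf_eq, abs_zero, add_zero]; exact hx
  -- the energy densities at `t = 0` on the near half-line
  have hdiff_t : ∀ x, x < e₀ → deriv (fun τ => ψ τ x - p τ x) 0 = g x - deriv (fun τ => p τ x) 0 := by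
    intro x hx
    have h1 : DifferentiableAt ℝ (fun τ => ψ τ x) 0 :=
      differentiableAt_slice_fst_of_contDiffOn isOpen_univ hψ.contDiffOn (mem_univ _)
    have h2 : DifferentiableAt ℝ (fun τ => p τ x) 0 :=
      differentiableAt_slice_fst_of_contDiffOn hNo hpC' (hmem0 x hx)
    exact deriv_sub h1 h2
  have hdiff_x : ∀ x, x < e₀ → deriv (fun y => ψ 0 y - p 0 y) x = -deriv (p 0) x := by
    intro x hx
    have h2 : DifferentiableAt ℝ (p 0) x :=
      differentiableAt_slice_snd_of_contDiffOn hNo hpC' (hmem0 x hx)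
    have : (fun y => ψ 0 y - p 0 y) = fun y => 0 - p 0 y := funext fun y => by rw [h0]
    rw [this, deriv_const_sub]
  have hedef : ∀ x, x < e₀ → energyDensity V (fun t y => ψ t y - p t y) 0 x
      = (g x - deriv (fun τ => p τ x) 0) ^ 2 + deriv (p 0) x ^ 2 + V x * p 0 x ^ 2 := by
    intro x hx
    unfold energyDensity
    beta_reduce
    rw [hdiff_t x hx, hdiff_x x hx, h0 x]
    ring
  -- case split on the near deficit of `ψ − p`
  by_cases hD : ∫⁻ x in Iio e₀, ENNReal.ofReal (energyDensity V (fun t y => ψ t y - p t y) 0 x) = ⊤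
  · rw [hD]; exact le_top
  · -- finite near energy of `p` at `t = 0`
    have hfinp : ∫⁻ x in Iio e₀, ENNReal.ofReal
        (deriv (fun τ => p τ x) 0 ^ 2 + deriv (p 0) x ^ 2 + V x * p 0 x ^ 2) < ⊤ := by
      have hpt : ∀ x ∈ Iio e₀, ENNReal.ofReal
          (deriv (fun τ => p τ x) 0 ^ 2 + deriv (p 0) x ^ 2 + V x * p 0 x ^ 2)
          ≤ ENNReal.ofReal (2 * energyDensity V (fun t y => ψ t y - p t y) 0 x)
            + ENNReal.ofReal (2 * g x ^ 2) := by
        intro x hx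
        rw [← ENNReal.ofReal_add (by
            have := Literature.Geometry.Lorentzian.ReggeWheeler.energyDensity_nonneg
              (V := V) (fun t y => ψ t y - p t y) 0 (hV0 x)
            positivity) (by positivity)]
        refine ENNReal.ofReal_le_ofReal ?_
        rw [hedef x hx]
        set q := deriv (fun τ => p τ x) 0
        have hq : q ^ 2 ≤ 2 * (g x - q) ^ 2 + 2 * g x ^ 2 := by nlinarith [sq_nonneg (2 * g x - q)]
        nlinarith [sq_nonneg (deriv (p 0) x), mul_nonneg (hV0 x) (sq_nonneg (p 0 x))]
      have hmeas : AEMeasurable (fun x => ENNReal.ofReal (2 * g x ^ 2)) (volume.restrict (Iio e₀)) :=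
        (ENNReal.measurable_ofReal.comp (by fun_prop : Measurable fun x => 2 * g x ^ 2)).aemeasurable
      calc ∫⁻ x in Iio e₀, ENNReal.ofReal
            (deriv (fun τ => p τ x) 0 ^ 2 + deriv (p 0) x ^ 2 + V x * p 0 x ^ 2)
          ≤ ∫⁻ x in Iio e₀, (ENNReal.ofReal (2 * energyDensity V (fun t y => ψ t y - p t y) 0 x)
              + ENNReal.ofReal (2 * g x ^ 2)) := setLIntegral_mono' measurableSet_Iio hpt
        _ = (∫⁻ x in Iio e₀, ENNReal.ofReal (2 * energyDensity V (fun t y => ψ t y - p t y) 0 x))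
              + ∫⁻ x in Iio e₀, ENNReal.ofReal (2 * g x ^ 2) := lintegral_add_right' _ hmeas
        _ < ⊤ := by
          refine ENNReal.add_lt_top.2 ⟨?_, ?_⟩
          · have h2 : (∫⁻ x in Iio e₀, ENNReal.ofReal
                (2 * energyDensity V (fun t y => ψ t y - p t y) 0 x))
                = 2 * ∫⁻ x in Iio e₀, ENNReal.ofReal
                    (energyDensity V (fun t y => ψ t y - p t y) 0 x) := by
              rw [← lintegral_const_mul' _ _ ENNReal.ofNat_ne_top]
              refine lintegral_congr fun x => ?_
              rw [ENNReal.ofReal_mul (by norm_num)]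
              simp
            rw [h2]
            exact ENNReal.mul_lt_top ENNReal.ofNat_lt_top (lt_top_iff_ne_top.2 hD)
          · have h2 : (∫⁻ x in Iio e₀, ENNReal.ofReal (2 * g x ^ 2))
                = 2 * ∫⁻ x in Iio e₀, ENNReal.ofReal (g x ^ 2) := by
              rw [← lintegral_const_mul' _ _ ENNReal.ofNat_ne_top]
              refine lintegral_congr fun x => ?_
              rw [ENNReal.ofReal_mul (by norm_num)]
              simp
            rw [h2]
            exact ENNReal.mul_lt_top ENNReal.ofNat_lt_top hfin
    -- the census: `p` is static on the near cone
    have hstatic := static_of_finite_energy hV hV0 hκ hC hVexp hpC' hsol' hpoly' hfinp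
    -- hence `p_t(0, ·) = 0` on the near half-line
    have hpt0 : ∀ x, x < e₀ → deriv (fun τ => p τ x) 0 = 0 := by
      intro x hx
      have hev : (fun τ => p τ x) =ᶠ[𝓝 0] fun _ => p 0 x := by
        have hpos : 0 < e₀ - x := by linarith
        filter_upwards [Ioo_mem_nhds (show -(e₀ - x) < 0 by linarith) hpos] with τ hτ
        have hz : x + |τ| < e₀ := by
          have : |τ| < e₀ - x := abs_lt.2 ⟨hτ.1, hτ.2⟩
          linarith
        exact hstatic (τ, x) hz
      rw [hev.deriv_eq, deriv_const]
    -- pointwise comparison and conclusion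
    refine setLIntegral_mono' measurableSet_Iio fun x hx => ?_
    refine ENNReal.ofReal_le_ofReal ?_
    rw [hedef x hx, hpt0 x hx]
    nlinarith [sq_nonneg (deriv (p 0) x), mul_nonneg (hV0 x) (sq_nonneg (p 0 x))]

/-- **Registered sub-goal `stub_kernelDeficit_ge_velocityEnergy`** (item stmt-FinalStateConjecture-10045,
prover seat 1): the Regge–Wheeler instance along a tortoise radius function, any `s ≤ ℓ` and any
aperture `ρ` (the horizon tail `V ≤ C_ℓ e^{x/2M}` is `rwPotential_tortoise_le_exp`). -/
theorem stub_kernelDeficit_ge_velocityEnergy :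
    ∀ (M : ℝ) (r : ℝ → ℝ) (xc : ℝ), Literature.Geometry.Lorentzian.ReggeWheeler.IsTortoiseRadius M r xc →
      ∀ (s ℓ : ℕ), s ≤ ℓ →
      ∀ (ρ : ℝ) (ψ : ℝ → ℝ → ℝ), ContDiff ℝ 2 (Function.uncurry ψ) → (∀ x, ψ 0 x = 0) →
      (∫⁻ x in Set.Iio (xc - ρ), ENNReal.ofReal (deriv (fun τ => ψ τ x) 0 ^ 2)) < ⊤ →
      (∫⁻ x in Set.Iio (xc - ρ), ENNReal.ofReal (deriv (fun τ => ψ τ x) 0 ^ 2))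
        ≤ Literature.Geometry.Lorentzian.ReggeWheeler.kernelDeficit
            (Literature.Geometry.Lorentzian.ReggeWheeler.linePotential M s ℓ r) xc ρ ψ := by
  intro M r xc hr s ℓ hsℓ ρ ψ hψ h0 hfin
  have hM := hr.mass_pos
  have hV : ContDiff ℝ 1 (linePotential M s ℓ r) :=
    ChannelsResolveTameDevelopments.Negative.contDiff_one_linePotential hr s ℓ
  have hV0 : ∀ x, 0 ≤ linePotential M s ℓ r x := linePotential_nonneg hM.le hsℓ hr.two_mul_lt
  -- the horizon tail bound, valid for all `x`
  set C : ℝ := ((ℓ : ℝ) * ((ℓ : ℝ) + 1) + 1) / (2 * M) ^ 3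
    * Real.exp ((-xc + Literature.Barriers.FinalStateConjecture.efTortoiseCoord M (3 * M) - 2 * M)
      / (2 * M)) with hC_def
  have hC : 0 ≤ C := by simp only [hC_def]; positivity
  have hκ : 0 < 1 / (2 * M) := by positivity
  have hVexp : ∀ x < xc - ρ, linePotential M s ℓ r x ≤ C * Real.exp (1 / (2 * M) * x) := by
    intro x _
    have h := rwPotential_tortoise_le_exp hM hr.two_mul_lt hr.hasDerivAt hr.center s ℓ x
    rw [linePotential_apply]
    refine h.trans (le_of_eq ?_)
    simp only [hC_def]
    rw [mul_assoc, ← Real.exp_add]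
    congr 2
    field_simp
    ring
  exact lintegral_velocity_sq_le_kernelDeficit hV hV0 hκ hC hVexp hψ h0 hfin

end Summit.FinalStateConjecture.FinalStateConjecture.Theorems.RestPacket

end
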